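import Summits.HodgeConjecture.CorCM.CyclicTimesPrimeCMTypes
import Mathlib.RingTheory.RootsOfUnity.Complex
import Mathlib.GroupTheory.SpecificGroups.Cyclic
import HarnessLib

/-!
# Cyclic groups of order `2^{a+1} m`, `m` odd and COMPOSITE: an explicit PRIMITIVE DEGENERATE CM type
# (group level) — the converse of `CorCM/CyclicTwoPowerCMTypes` + `CorCM/CyclicTimesPrimeCMTypes`

COR-CM (cell `pub-hodgecm2`), binder seat b04 (gen 12), count-neutral sequel of CYCLO-RANK-CENSUS (claim
CYCLIC-CLASSIF).  KERNEL ONLY: theorems; no definition, no named fact, no `sorry`.  Gen 11 proved that for a CYCLIC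
Galois group of order `2^{a+1} m`, `m` odd, every primitive CM type is nondegenerate when `m = 1` (all types,
`CyclicTwoPower.isNondegenerate_of_isCyclic`) or `m` is prime (`…isNondegenerate_of_isPrimitive_of_isCyclic`); this
file is the converse at the level of the group, the number-field dress and the classification
«every primitive type nondegenerate ⟺ `m ∈ {1} ∪ primes`» being the sequel `CorCM/CyclicCMTypesClassification.lean`.

THEOREM (`exists_primitive_degenerate`).  Let `G = ⟨γ⟩`, `ord γ = 2^{a+1} m`, `m` odd, `l ∣ m`, `2 ≤ l < m`;
`M = 2^a`, `γ₂ = γ^m` (order `2M`), `γ_m = γ^{2M}` (order `m`), `ρ = γ^{Mm} = γ₂^M`.  Every element is uniquely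
`γ₂^r γ_m^s` (`r < 2M`, `s < m`; `exists_coords`), and the INFLATED BLOCK TYPE
`S = {γ₂^r γ_m^s : (r < M ∧ l ≤ s) ∨ (M ≤ r ∧ s < l)}` is a CM type for `ρ` (`isCMTypeWith_inflatedBlockType`) with
odd-character sums `Σ_{x∈S} χ(x) = (Σ_{r<M} ω^r)(Σ_{s<m} η^s − 2Σ_{s<l} η^s)`, `ω = χ(γ₂)`, `η = χ(γ_m)`
(`sum_oddChar_inflatedBlockType`): KILLED by the odd character `χ(γ) = e^{2πi/(2^{a+1} l)}` (`η` a primitive `l`-th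
root of unity; `exists_oddChar_sum_eq_zero`) — DEGENERATE by Kubota's Lemma 2 — and NOT by the faithful one
`χ₁(γ) = e^{2πi/(2^{a+1} m)}` (`sum_faithfulChar_ne_zero`), whence the translates of `S` separate points
(`separating_of_faithful`: `S·t = S` forces `χ₁(t) = 1`) — PRIMITIVE in Shimura's sense, in the form consumed by
`isPrimitive_iff_forall_eq`.

For `a = 0`, `G = ⟨ρ⟩ × ⟨γ_m⟩` and `S = {γ_m^s : l ≤ s} ∪ {ργ_m^s : s < l}` is DODSON's block type `Φᶠ`,
`f = (1_l, 0, …, 0)` [Dodson1984, §3.2.1 "A Converse of Ribet's Theorem"], formalised on `⟨ρ⟩ × ⟨σ⟩` in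
`Literature/NumberTheory/ComplexMultiplication/DegenerateCMTypesCompositeDimension.lean` (lit-deligne-3, DODSON-CONVERSE;
cited, neither imported nor restated).  The point here is the NON-SPLIT `2`-part `a ≥ 1` (`n = 2^a m` even: `ℤ/2n`
has no `σ` of order `n` with `ρ ∉ ⟨σ⟩`, so Dodson's hypothesis is unsatisfiable — `ℚ(ζ₃₇)`, `ℚ(ζ₆₁)`, `ℚ(ζ₇₃)`),
treated uniformly with `a = 0` by inflating `Φᶠ` from the subgroup `⟨ρ⟩ × ⟨γ_m⟩` along `⟨γ₂⟩`: `S = ⊔_{r<M} γ₂^r Φᶠ`.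

## References

* [Dodson1984] B. Dodson, *The structure of Galois groups of CM-fields*, Trans. AMS 283 (1984), §3.1.1, §3.2.1.
* [Kubota1965] T. Kubota, *On the field extension by complex multiplication*, Trans. AMS 118 (1965), §4 Lemma 2.
* [Shimura1998] G. Shimura, *Abelian Varieties with Complex Multiplication and Modular Functions*, §8.2 Prop. 26.
* [Gordon1999HodgeAVSurvey] B. B. Gordon, *A survey of the Hodge conjecture for abelian varieties*, Prop. 9.4.1, §9.4.2.
-/

noncomputable section

namespace Summit.HodgeConjecture.CorCM.CyclicComposite

open Literature.NumberTheory.ComplexMultiplication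
open Summit.HodgeConjecture.CorCM.CyclicTwoPower (exponents_eq_of_pow_eq)

variable {G : Type*} [Group G] [Fintype G] [DecidableEq G]

/-! ### §1 Coordinates `γ₂^r γ_m^s` on a cyclic group of order `2Mm`, `gcd(2M, m) = 1` -/

omit [Fintype G] [DecidableEq G] in
/-- `γ₂^i γ_m^j = γ^{m i + 2M j}` for `γ₂ = γ^m`, `γ_m = γ^{2M}`. [folklore] -/
theorem pow_mul_pow_eq (γ : G) (M m i j : ℕ) :
    (γ ^ m) ^ i * (γ ^ (2 * M)) ^ j = γ ^ (m * i + 2 * M * j) := by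
  rw [← pow_mul, ← pow_mul, ← pow_add]

omit [DecidableEq G] in
/-- **Every element of `G = ⟨γ⟩`, `ord γ = 2Mm`, `gcd(2M, m) = 1`, is `γ₂^r γ_m^s` with `r < 2M`, `s < m`**
(`(r, s) ↦ γ₂^r γ_m^s` is injective on `[0, 2M) × [0, m)` by `CyclicTwoPower.exponents_eq_of_pow_eq`, and
`|G| = 2Mm`). [folklore] -/
theorem exists_coords {γ : G} {M m : ℕ} (hγ : orderOf γ = 2 * M * m) (hcop : (2 * M).Coprime m)
    (hgen : ∀ x : G, x ∈ Submonoid.powers γ) (x : G) :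
    ∃ r < 2 * M, ∃ s < m, x = (γ ^ m) ^ r * (γ ^ (2 * M)) ^ s := by
  let e : Fin (2 * M) × Fin m → G := fun rs => (γ ^ m) ^ (rs.1 : ℕ) * (γ ^ (2 * M)) ^ (rs.2 : ℕ)
  have hinj : Function.Injective e := by
    rintro ⟨r, s⟩ ⟨r', s'⟩ h
    dsimp only [e] at h
    rw [pow_mul_pow_eq, pow_mul_pow_eq] at h
    obtain ⟨h1, h2⟩ := exponents_eq_of_pow_eq hγ hcop r.2 r'.2 s.2 s'.2 h
    exact Prod.ext (Fin.ext h1) (Fin.ext h2)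
  have hcard : Fintype.card G = 2 * M * m := by
    rw [← hγ, orderOf_eq_card_of_forall_mem_powers hgen, Nat.card_eq_fintype_card]
  have hbij : Function.Bijective e := by
    rw [Fintype.bijective_iff_injective_and_card]
    exact ⟨hinj, by rw [Fintype.card_prod, Fintype.card_fin, Fintype.card_fin, hcard]⟩
  obtain ⟨⟨r, s⟩, hrs⟩ := hbij.2 x
  exact ⟨r, r.2, s, s.2, hrs.symm⟩

/-! ### §2 Characters of a cyclic group with prescribed value on the generator; faithful characters separate -/

omit [DecidableEq G] in
/-- **A character with prescribed value on the generator**: for `ζ ∈ ℂ` with `ζ^{ord γ} = 1` there is a character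
`χ` of `G = ⟨γ⟩` with `χ(γ) = ζ` (Mathlib `monoidHomOfForallMemZpowers`). [folklore] -/
theorem exists_addChar_apply_eq {γ : G} (hgen : ∀ x : G, x ∈ Submonoid.powers γ) {ζ : ℂ}
    (hζ : ζ ^ orderOf γ = 1) : ∃ χ : AddChar (Additive G) ℂ, χ (Additive.ofMul γ) = ζ := by
  have hζ0 : ζ ≠ 0 := fun h => by rw [h, zero_pow (orderOf_pos γ).ne'] at hζ; exact zero_ne_one hζ
  set u : ℂˣ := Units.mk0 ζ hζ0 with hu
  have hord : orderOf u ∣ orderOf γ := by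
    refine orderOf_dvd_of_pow_eq_one (Units.ext ?_)
    rw [Units.val_pow_eq_pow_val, hu, Units.val_mk0, hζ, Units.val_one]
  have hgen' : ∀ x : G, x ∈ Subgroup.zpowers γ := fun x => mem_powers_iff_mem_zpowers.1 (hgen x)
  set ψ : G →* ℂˣ := monoidHomOfForallMemZpowers hgen' hord with hψ
  have hψγ : ψ γ = u := monoidHomOfForallMemZpowers_apply_gen hgen' hord
  refine ⟨⟨fun x => ((ψ (Additive.toMul x) : ℂˣ) : ℂ), ?_, ?_⟩, ?_⟩
  · simp only [toMul_zero, map_one, Units.val_one]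
  · intro x y
    simp only [toMul_add, map_mul, Units.val_mul]
  · change ((ψ (Additive.toMul (Additive.ofMul γ)) : ℂˣ) : ℂ) = ζ
    rw [toMul_ofMul, hψγ, hu, Units.val_mk0]

omit [Fintype G] [DecidableEq G] in
/-- `χ(γ^e) = χ(γ)^e`. [folklore] -/
theorem addChar_ofMul_pow (χ : AddChar (Additive G) ℂ) (g : G) (e : ℕ) :
    χ (Additive.ofMul (g ^ e)) = χ (Additive.ofMul g) ^ e := by
  rw [ofMul_pow, AddChar.map_nsmul_eq_pow]

omit [Fintype G] [DecidableEq G] in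
/-- `χ(gh) = χ(g)χ(h)`. [folklore] -/
theorem addChar_ofMul_mul (χ : AddChar (Additive G) ℂ) (g h : G) :
    χ (Additive.ofMul (g * h)) = χ (Additive.ofMul g) * χ (Additive.ofMul h) := by
  rw [ofMul_mul, AddChar.map_add_eq_mul]

omit [Fintype G] [DecidableEq G] in
/-- **A character of `⟨γ⟩` taking a PRIMITIVE `ord γ`-th root of unity at `γ` is faithful.** [folklore] -/
theorem faithful_of_isPrimitiveRoot {γ : G} (hgen : ∀ x : G, x ∈ Submonoid.powers γ)
    (χ : AddChar (Additive G) ℂ) (hχ : IsPrimitiveRoot (χ (Additive.ofMul γ)) (orderOf γ)) (g : G)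
    (hg : χ (Additive.ofMul g) = 1) : g = 1 := by
  obtain ⟨i, rfl⟩ := (Submonoid.mem_powers_iff _ _).1 (hgen g)
  rw [addChar_ofMul_pow] at hg
  exact orderOf_dvd_iff_pow_eq_one.1 ((hχ.pow_eq_one_iff_dvd i).1 hg)

omit [Fintype G] in
/-- **A faithful character which does not vanish on `S` makes the translates of `S` separate points**: if
`gx ∈ S ↔ gy ∈ S` for all `g`, then `S·(x⁻¹y) = S`, so `Σ_S χ = χ(x⁻¹y) Σ_S χ`, `χ(x⁻¹y) = 1`, `x = y`.  (This is
Dodson's "the orbit of `f` under `G` has order `2n`" read through one character.) [cite: Dodson1984, §3.2.1 (proof)] -/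
theorem separating_of_faithful {S : Finset G} (χ : AddChar (Additive G) ℂ)
    (hS : ∑ s ∈ S, χ (Additive.ofMul s) ≠ 0) (hfaith : ∀ g : G, χ (Additive.ofMul g) = 1 → g = 1)
    (x y : G) (hxy : ∀ g : G, g * x ∈ S ↔ g * y ∈ S) : x = y := by
  set t : G := x⁻¹ * y with ht
  have hmap : ∀ s ∈ S, s * t ∈ S := fun s hs => by
    have h := (hxy (s * x⁻¹)).1 (by rwa [inv_mul_cancel_right])
    rwa [mul_assoc] at h
  have himage : S.image (· * t) = S :=
    Finset.eq_of_subset_of_card_le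
      (fun z hz => by obtain ⟨s, hs, rfl⟩ := Finset.mem_image.1 hz; exact hmap s hs)
      (by rw [Finset.card_image_of_injective _ (mul_left_injective t)])
  have hsum : ∑ s ∈ S, χ (Additive.ofMul s) = χ (Additive.ofMul t) * ∑ s ∈ S, χ (Additive.ofMul s) := by
    conv_lhs => rw [← himage]
    rw [Finset.sum_image fun a _ b _ h => mul_left_injective t h, Finset.mul_sum]
    exact Finset.sum_congr rfl fun s _ => by rw [addChar_ofMul_mul, mul_comm]
  have hχt : χ (Additive.ofMul t) = 1 := by
    have h : (χ (Additive.ofMul t) - 1) * ∑ s ∈ S, χ (Additive.ofMul s) = 0 := by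
      rw [sub_mul, one_mul, ← hsum, sub_self]
    exact sub_eq_zero.1 ((mul_eq_zero.1 h).resolve_right hS)
  have := hfaith t hχt
  rw [ht, inv_mul_eq_one] at this
  exact this

/-! ### §3 The inflated block type on a cyclic group of order `2^{a+1} m` -/

section InflatedBlockType

variable {γ : G} {a m l : ℕ}

omit [Fintype G] [DecidableEq G] in
/-- `2^{a+1} m = 2 · 2^a · m`. [folklore] -/
private theorem orderOf_eq' (hγ : orderOf γ = 2 ^ (a + 1) * m) : orderOf γ = 2 * 2 ^ a * m := by
  rw [hγ, pow_succ, mul_comm (2 ^ a) 2]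

/-- `gcd(2^{a+1}, m) = 1` for odd `m`. [folklore] -/
private theorem coprime_two_mul_two_pow (hm : Odd m) : (2 * 2 ^ a).Coprime m := by
  rw [← pow_succ']
  exact (Nat.coprime_two_left.2 hm).pow_left _

omit [Fintype G] in
/-- **Membership in the inflated block type, in coordinates**: for `r < 2M`, `s < m`,
`γ₂^r γ_m^s ∈ S ↔ (r < M ∧ l ≤ s) ∨ (M ≤ r ∧ s < l)`. [cite: Dodson1984, §3.2.1] -/
theorem mem_inflatedBlockType_iff (hγ : orderOf γ = 2 ^ (a + 1) * m) (hm : Odd m) (S : Finset G)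
    (hS : S = (Finset.range (2 ^ a) ×ˢ Finset.range m).image fun rs : ℕ × ℕ =>
      (γ ^ m) ^ (rs.1 + if rs.2 < l then 2 ^ a else 0) * (γ ^ (2 * 2 ^ a)) ^ rs.2)
    {r s : ℕ} (hr : r < 2 * 2 ^ a) (hs : s < m) :
    (γ ^ m) ^ r * (γ ^ (2 * 2 ^ a)) ^ s ∈ S ↔ (r < 2 ^ a ∧ l ≤ s) ∨ (2 ^ a ≤ r ∧ s < l) := by
  have hγ' := orderOf_eq' hγ
  have hcop := coprime_two_mul_two_pow (a := a) hm
  subst hS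
  rw [Finset.mem_image]
  constructor
  · rintro ⟨⟨r', s'⟩, hmem, heq⟩
    rw [Finset.mem_product, Finset.mem_range, Finset.mem_range] at hmem
    dsimp only at heq
    rw [pow_mul_pow_eq, pow_mul_pow_eq] at heq
    have hr' : (r' + if s' < l then 2 ^ a else 0) < 2 * 2 ^ a := by split_ifs <;> omega
    obtain ⟨h1, rfl⟩ := exponents_eq_of_pow_eq hγ' hcop hr' hr hmem.2 hs heq
    by_cases hsl : s' < l
    · rw [if_pos hsl] at h1; exact Or.inr ⟨by omega, hsl⟩
    · rw [if_neg hsl] at h1; exact Or.inl ⟨by omega, by omega⟩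
  · rintro (⟨hrM, hls⟩ | ⟨hMr, hsl⟩)
    · exact ⟨(r, s), by rw [Finset.mem_product, Finset.mem_range, Finset.mem_range]; exact ⟨hrM, hs⟩,
        by dsimp only; rw [if_neg (by omega), add_zero]⟩
    · exact ⟨(r - 2 ^ a, s), by rw [Finset.mem_product, Finset.mem_range, Finset.mem_range]; exact ⟨by omega, hs⟩,
        by dsimp only; rw [if_pos hsl, Nat.sub_add_cancel hMr]⟩

/-- **The inflated block type is a CM type for `ρ = γ^{2^a m} = γ₂^{2^a}`** (it contains exactly one of `x`, `ρx`
for every `x = γ₂^r γ_m^s`: `ρ` shifts `r` by `M` modulo `2M`, exchanging the two clauses of the membership rule).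
[cite: Dodson1984, §3.2.1] -/
theorem isCMTypeWith_inflatedBlockType (hγ : orderOf γ = 2 ^ (a + 1) * m) (hgen : ∀ x : G, x ∈ Submonoid.powers γ)
    (hm : Odd m) (S : Finset G)
    (hS : S = (Finset.range (2 ^ a) ×ˢ Finset.range m).image fun rs : ℕ × ℕ =>
      (γ ^ m) ^ (rs.1 + if rs.2 < l then 2 ^ a else 0) * (γ ^ (2 * 2 ^ a)) ^ rs.2) :
    IsCMTypeWith (γ ^ (2 ^ a * m)) (S : Set G) := by
  have hγ' := orderOf_eq' hγ
  have hcop := coprime_two_mul_two_pow (a := a) hm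
  have hcomm : ∀ g h : G, g * h = h * g := fun g h => by
    obtain ⟨i, rfl⟩ := (Submonoid.mem_powers_iff _ _).1 (hgen g)
    obtain ⟨j, rfl⟩ := (Submonoid.mem_powers_iff _ _).1 (hgen h)
    rw [← pow_add, ← pow_add, add_comm]
  -- `ρ = γ₂^M`, `γ₂^{2M} = 1`
  have hρ : γ ^ (2 ^ a * m) = (γ ^ m) ^ 2 ^ a := by rw [← pow_mul, mul_comm]
  have hγ₂ : (γ ^ m) ^ (2 * 2 ^ a) = 1 := by
    rw [← pow_mul, ← orderOf_dvd_iff_pow_eq_one, hγ']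
    exact ⟨1, by ring⟩
  have hρ2 : γ ^ (2 ^ a * m) * γ ^ (2 ^ a * m) = 1 := by
    rw [hρ, ← pow_add, ← two_mul, hγ₂]
  refine ⟨fun x => ?_, fun g x => ?_, fun x => ?_⟩
  · obtain ⟨r, hr, s, hs, rfl⟩ := exists_coords hγ' hcop hgen x
    rw [Finset.mem_coe, Finset.mem_coe, smul_eq_mul, hρ, ← mul_assoc, ← pow_add,
      pow_eq_pow_mod (2 ^ a + r) hγ₂, mem_inflatedBlockType_iff hγ hm S hS hr hs,
      mem_inflatedBlockType_iff hγ hm S hS (Nat.mod_lt _ (by positivity)) hs]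
    by_cases hrM : r < 2 ^ a
    · rw [Nat.mod_eq_of_lt (show 2 ^ a + r < 2 * 2 ^ a by omega)]
      omega
    · rw [show 2 ^ a + r = (r - 2 ^ a) + 2 * 2 ^ a by omega, Nat.add_mod_right,
        Nat.mod_eq_of_lt (show r - 2 ^ a < 2 * 2 ^ a by omega)]
      omega
  · change g * (γ ^ (2 ^ a * m) * x) = γ ^ (2 ^ a * m) * (g * x)
    rw [← mul_assoc, hcomm g, mul_assoc]
  · change γ ^ (2 ^ a * m) * (γ ^ (2 ^ a * m) * x) = x
    rw [← mul_assoc, hρ2, one_mul]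

omit [Fintype G] in
/-- **The odd character sums over the inflated block type** (the constant weight criterion in character form,
inflated along `⟨γ₂⟩`): for `χ(ρ) = −1`, `ω = χ(γ₂)`, `η = χ(γ_m)`,
`Σ_{x ∈ S} χ(x) = (Σ_{r<M} ω^r) · (Σ_{s<m} η^s − 2 Σ_{s<l} η^s)`. [cite: Dodson1984, §3.1.1, §3.2.1]
[cite: Kubota1965, §4 Lemma 2] -/
theorem sum_oddChar_inflatedBlockType (hγ : orderOf γ = 2 ^ (a + 1) * m) (hm : Odd m) (hlm : l ≤ m)
    (S : Finset G)
    (hS : S = (Finset.range (2 ^ a) ×ˢ Finset.range m).image fun rs : ℕ × ℕ =>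
      (γ ^ m) ^ (rs.1 + if rs.2 < l then 2 ^ a else 0) * (γ ^ (2 * 2 ^ a)) ^ rs.2)
    (χ : AddChar (Additive G) ℂ) (hχ : χ (Additive.ofMul (γ ^ (2 ^ a * m))) = -1) :
    ∑ x ∈ S, χ (Additive.ofMul x) =
      (∑ r ∈ Finset.range (2 ^ a), χ (Additive.ofMul (γ ^ m)) ^ r) *
        (∑ s ∈ Finset.range m, χ (Additive.ofMul (γ ^ (2 * 2 ^ a))) ^ s -
          2 * ∑ s ∈ Finset.range l, χ (Additive.ofMul (γ ^ (2 * 2 ^ a))) ^ s) := by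
  have hγ' := orderOf_eq' hγ
  have hcop := coprime_two_mul_two_pow (a := a) hm
  set ω : ℂ := χ (Additive.ofMul (γ ^ m)) with hω
  set η : ℂ := χ (Additive.ofMul (γ ^ (2 * 2 ^ a))) with hη
  have hωM : ω ^ 2 ^ a = -1 := by
    rw [hω, ← addChar_ofMul_pow, ← pow_mul, mul_comm, hχ]
  subst hS
  -- the parametrisation is injective
  rw [Finset.sum_image]
  swap
  · rintro ⟨r, s⟩ hrs ⟨r', s'⟩ hrs' h
    rw [Finset.mem_coe, Finset.mem_product, Finset.mem_range, Finset.mem_range] at hrs hrs'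
    dsimp only at h
    rw [pow_mul_pow_eq, pow_mul_pow_eq] at h
    have h1 : (r + if s < l then 2 ^ a else 0) < 2 * 2 ^ a := by split_ifs <;> omega
    have h2 : (r' + if s' < l then 2 ^ a else 0) < 2 * 2 ^ a := by split_ifs <;> omega
    obtain ⟨h3, h4⟩ := exponents_eq_of_pow_eq hγ' hcop h1 h2 hrs.2 hrs'.2 h
    subst h4
    simp only [add_left_inj] at h3
    rw [h3]
  rw [Finset.sum_product]
  -- each term is `ω^r · c_s` with `c_s = η^s − 2[s<l]η^s`
  have hterm : ∀ r s : ℕ, χ (Additive.ofMul ((γ ^ m) ^ (r + if s < l then 2 ^ a else 0) *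
      (γ ^ (2 * 2 ^ a)) ^ s)) = ω ^ r * (η ^ s - 2 * if s < l then η ^ s else 0) := by
    intro r s
    rw [addChar_ofMul_mul, addChar_ofMul_pow χ (γ ^ m), addChar_ofMul_pow χ (γ ^ (2 * 2 ^ a)), ← hω, ← hη,
      pow_add]
    split_ifs with h
    · rw [hωM]; ring
    · rw [pow_zero]; ring
  simp_rw [hterm]
  have hfilter : (Finset.range m).filter (fun s => s < l) = Finset.range l := by
    ext s; simp only [Finset.mem_filter, Finset.mem_range]; omega
  rw [Finset.sum_mul]
  refine Finset.sum_congr rfl fun r _ => ?_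
  rw [← Finset.mul_sum, Finset.sum_sub_distrib, ← Finset.mul_sum, ← Finset.sum_filter, hfilter]

/-- **An odd character KILLS the inflated block type**: `χ(γ) = e^{2πi/(2^{a+1} l)}` is a character (`l ∣ m`), odd
(`m/l` odd), with `η = χ(γ_m)` a primitive `l`-th root of unity, so `Σ_{s<l} η^s = Σ_{s<m} η^s = 0`.  By Kubota's
Lemma 2 the type is DEGENERATE. [cite: Dodson1984, §3.2.1] [cite: Kubota1965, §4 Lemma 2] -/
theorem exists_oddChar_sum_eq_zero (hγ : orderOf γ = 2 ^ (a + 1) * m) (hgen : ∀ x : G, x ∈ Submonoid.powers γ)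
    (hm : Odd m) (hlm : l ∣ m) (h2l : 2 ≤ l) (S : Finset G)
    (hS : S = (Finset.range (2 ^ a) ×ˢ Finset.range m).image fun rs : ℕ × ℕ =>
      (γ ^ m) ^ (rs.1 + if rs.2 < l then 2 ^ a else 0) * (γ ^ (2 * 2 ^ a)) ^ rs.2) :
    ∃ χ : AddChar (Additive G) ℂ, χ (Additive.ofMul (γ ^ (2 ^ a * m))) = -1 ∧
      ∑ x ∈ S, χ (Additive.ofMul x) = 0 := by
  obtain ⟨k, hk⟩ := hlm
  have hl0 : 0 < l := by omega
  have hk0 : 0 < k := Nat.pos_of_ne_zero fun h => by rw [h, mul_zero] at hk; exact hm.pos.ne' hk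
  have hkodd : Odd k := (Nat.odd_mul.1 (hk ▸ hm)).2
  -- `ζ` a primitive `2^{a+1} l`-th root of unity
  set d : ℕ := 2 ^ (a + 1) * l with hd
  have hd0 : d ≠ 0 := by positivity
  have hζ : IsPrimitiveRoot (Complex.exp (2 * Real.pi * Complex.I / d)) d := Complex.isPrimitiveRoot_exp d hd0
  set ζ : ℂ := Complex.exp (2 * Real.pi * Complex.I / d) with hζdef
  have hζN : ζ ^ orderOf γ = 1 := by
    rw [hγ, hk, show 2 ^ (a + 1) * (l * k) = d * k by rw [hd]; ring, pow_mul, hζ.pow_eq_one, one_pow]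
  obtain ⟨χ, hχ⟩ := exists_addChar_apply_eq hgen hζN
  -- `χ(ρ) = ζ^{2^a m} = (ζ^{2^a l})^k = (-1)^k = -1`
  have hhalf : ζ ^ (2 ^ a * l) = -1 :=
    (hζ.pow (by positivity) (by rw [hd, pow_succ]; ring)).eq_neg_one_of_two_right
  have hχρ : χ (Additive.ofMul (γ ^ (2 ^ a * m))) = -1 := by
    rw [addChar_ofMul_pow, hχ, hk, show 2 ^ a * (l * k) = 2 ^ a * l * k by ring, pow_mul, hhalf,
      hkodd.neg_one_pow]
  refine ⟨χ, hχρ, ?_⟩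
  rw [sum_oddChar_inflatedBlockType hγ hm (by rw [hk]; exact Nat.le_mul_of_pos_right l hk0) S hS χ hχρ]
  -- `η = ζ^{2^{a+1}}` is a primitive `l`-th root of unity
  have hη : IsPrimitiveRoot (χ (Additive.ofMul (γ ^ (2 * 2 ^ a)))) l := by
    rw [addChar_ofMul_pow, hχ]
    exact hζ.pow (by positivity) (by rw [hd, pow_succ]; ring)
  have hsumm : ∑ s ∈ Finset.range m, χ (Additive.ofMul (γ ^ (2 * 2 ^ a))) ^ s = 0 := by
    rw [geom_sum_eq (hη.ne_one h2l), hk, pow_mul, hη.pow_eq_one, one_pow, sub_self, zero_div]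
  rw [hη.geom_sum_eq_zero h2l, hsumm, mul_zero, sub_zero, mul_zero]

omit [Fintype G] in
/-- **The faithful odd character does NOT vanish on the inflated block type**: `χ₁(γ) = e^{2πi/(2^{a+1} m)}`,
`ω₁ = χ₁(γ₂)` a primitive `2^{a+1}`-th root (`Σ_{r<M} ω₁^r ≠ 0` as `ω₁^M = −1`), `η₁ = χ₁(γ_m)` a primitive `m`-th
root (`Σ_{s<m} η₁^s = 0`, `Σ_{s<l} η₁^s ≠ 0` as `m ∤ l`). [cite: Dodson1984, §3.2.1 (proof)] -/
theorem sum_faithfulChar_ne_zero (hγ : orderOf γ = 2 ^ (a + 1) * m) (hm : Odd m) (hl0 : 0 < l) (hl : l < m)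
    (S : Finset G)
    (hS : S = (Finset.range (2 ^ a) ×ˢ Finset.range m).image fun rs : ℕ × ℕ =>
      (γ ^ m) ^ (rs.1 + if rs.2 < l then 2 ^ a else 0) * (γ ^ (2 * 2 ^ a)) ^ rs.2)
    (χ : AddChar (Additive G) ℂ) (hχ : IsPrimitiveRoot (χ (Additive.ofMul γ)) (orderOf γ)) :
    χ (Additive.ofMul (γ ^ (2 ^ a * m))) = -1 ∧ ∑ x ∈ S, χ (Additive.ofMul x) ≠ 0 := by
  have hm0 : 0 < m := hm.pos
  rw [hγ] at hχ
  set ζ : ℂ := χ (Additive.ofMul γ) with hζdef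
  -- oddness
  have hχρ : χ (Additive.ofMul (γ ^ (2 ^ a * m))) = -1 := by
    rw [addChar_ofMul_pow, ← hζdef]
    exact (hχ.pow (by positivity) (by rw [pow_succ]; ring)).eq_neg_one_of_two_right
  refine ⟨hχρ, ?_⟩
  rw [sum_oddChar_inflatedBlockType hγ hm hl.le S hS χ hχρ]
  -- `ω₁`
  have hω : IsPrimitiveRoot (χ (Additive.ofMul (γ ^ m))) (2 * 2 ^ a) := by
    rw [addChar_ofMul_pow, ← hζdef]
    exact hχ.pow (by positivity) (by rw [pow_succ]; ring)
  have hωM : χ (Additive.ofMul (γ ^ m)) ^ 2 ^ a = -1 :=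
    (hω.pow (by positivity) (mul_comm _ _)).eq_neg_one_of_two_right
  have hsumω : ∑ r ∈ Finset.range (2 ^ a), χ (Additive.ofMul (γ ^ m)) ^ r ≠ 0 := by
    intro h0
    have h := geom_sum_mul (χ (Additive.ofMul (γ ^ m))) (2 ^ a)
    rw [h0, zero_mul, hωM] at h
    norm_num at h
  -- `η₁`
  have hη : IsPrimitiveRoot (χ (Additive.ofMul (γ ^ (2 * 2 ^ a)))) m := by
    rw [addChar_ofMul_pow, ← hζdef]
    exact hχ.pow (by positivity) (by rw [pow_succ]; ring)
  have h1m : 1 < m := by omega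
  have hsumm : ∑ s ∈ Finset.range m, χ (Additive.ofMul (γ ^ (2 * 2 ^ a))) ^ s = 0 := hη.geom_sum_eq_zero h1m
  have hηl : χ (Additive.ofMul (γ ^ (2 * 2 ^ a))) ^ l ≠ 1 := fun h =>
    Nat.not_dvd_of_pos_of_lt hl0 hl ((hη.pow_eq_one_iff_dvd l).1 h)
  have hsuml : ∑ s ∈ Finset.range l, χ (Additive.ofMul (γ ^ (2 * 2 ^ a))) ^ s ≠ 0 := by
    intro h0
    have h := geom_sum_mul (χ (Additive.ofMul (γ ^ (2 * 2 ^ a)))) l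
    rw [h0, zero_mul] at h
    exact hηl (sub_eq_zero.1 h.symm)
  rw [hsumm, zero_sub]
  exact mul_ne_zero hsumω (neg_ne_zero.2 (mul_ne_zero two_ne_zero hsuml))

/-- **The translates of the inflated block type separate points** (⟹ PRIMITIVE, Shimura §8.2 Prop. 26): the
faithful odd character does not vanish on `S`. [cite: Dodson1984, §3.2.1] [cite: Shimura1998, §8.2 Prop. 26] -/
theorem separating_inflatedBlockType (hγ : orderOf γ = 2 ^ (a + 1) * m) (hgen : ∀ x : G, x ∈ Submonoid.powers γ)
    (hm : Odd m) (hl0 : 0 < l) (hl : l < m) (S : Finset G)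
    (hS : S = (Finset.range (2 ^ a) ×ˢ Finset.range m).image fun rs : ℕ × ℕ =>
      (γ ^ m) ^ (rs.1 + if rs.2 < l then 2 ^ a else 0) * (γ ^ (2 * 2 ^ a)) ^ rs.2)
    (x y : G) (hxy : ∀ g : G, g * x ∈ S ↔ g * y ∈ S) : x = y := by
  have hζ : IsPrimitiveRoot (Complex.exp (2 * Real.pi * Complex.I / orderOf γ)) (orderOf γ) :=
    Complex.isPrimitiveRoot_exp _ (orderOf_pos γ).ne'
  obtain ⟨χ, hχ⟩ := exists_addChar_apply_eq hgen hζ.pow_eq_one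
  have hχ' : IsPrimitiveRoot (χ (Additive.ofMul γ)) (orderOf γ) := by rw [hχ]; exact hζ
  exact separating_of_faithful χ (sum_faithfulChar_ne_zero hγ hm hl0 hl S hS χ hχ').2
    (faithful_of_isPrimitiveRoot hgen χ hχ') x y hxy

/-- **Cyclic group of order `2^{a+1} m`, `m` odd with a divisor `1 < l < m`: a PRIMITIVE DEGENERATE CM type exists**
— a CM type for the involution `ρ = γ^{2^a m}` on which some odd character vanishes (degenerate, Kubota) and whose
translates separate points (primitive, Shimura).  The converse of `CyclicTwoPower.sum_ne_zero_of_orderOf_eq_two_pow`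
(`m = 1`) and `CyclicTwoPower.sum_ne_zero_of_orderOf_eq_two_pow_mul_prime` (`m` prime).
[cite: Dodson1984, §3.2.1] [cite: Kubota1965, §4 Lemma 2] [cite: Shimura1998, §8.2 Prop. 26] -/
theorem exists_primitive_degenerate (hγ : orderOf γ = 2 ^ (a + 1) * m) (hgen : ∀ x : G, x ∈ Submonoid.powers γ)
    (hm : Odd m) (hlm : l ∣ m) (h2l : 2 ≤ l) (hl : l < m) :
    ∃ S : Finset G, IsCMTypeWith (γ ^ (2 ^ a * m)) (S : Set G) ∧
      (∃ χ : AddChar (Additive G) ℂ, χ (Additive.ofMul (γ ^ (2 ^ a * m))) = -1 ∧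
        ∑ x ∈ S, χ (Additive.ofMul x) = 0) ∧
      ∀ x y : G, (∀ g : G, g * x ∈ S ↔ g * y ∈ S) → x = y :=
  ⟨_, isCMTypeWith_inflatedBlockType hγ hgen hm _ rfl, exists_oddChar_sum_eq_zero hγ hgen hm hlm h2l _ rfl,
    separating_inflatedBlockType hγ hgen hm (by omega) hl _ rfl⟩

end InflatedBlockType

end Summit.HodgeConjecture.CorCM.CyclicComposite

end
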